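import Mathlib.Analysis.Convex.Function
import Mathlib.MeasureTheory.Integral.IntervalIntegral.Basic
import Mathlib.Analysis.SpecialFunctions.Integrals.Basic
import HarnessLib

/-!
# Quadrature bounds for convex functions: the trapezoid rule from above, the midpoint rule from below

Trunk T-ANALYSIS support (`Analysis/Calculus`).  The two halves of the Hermite–Hadamard
inequality in the form used by certified quadrature: for `f` convex on a set containing `[a, b]`,

* `Literature.Analysis.Calculus.convexOn_le_chord` — `f(x) ≤ ((b−x)f(a) + (x−a)f(b))/(b−a)` on `[a, b]`;
* `Literature.Analysis.Calculus.convexOn_integral_le_trapezoid` — `∫_a^b f ≤ (b−a)(f(a)+f(b))/2`;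
* `Literature.Analysis.Calculus.convexOn_midpoint_le_integral` — `(b−a) f((a+b)/2) ≤ ∫_a^b f`.

(Mathlib has Jensen's inequality for integrals, `ConvexOn.map_set_average_le`, from which the
midpoint bound also follows; the elementary symmetrisation proof is kept here to avoid the
measure-theoretic averaging API.)  Used for the constants of Turing's method (`∫ log ζ(σ) dσ`,
`log ζ` convex: `LogZetaConvex.lean`).

## References

* G. H. Hardy, J. E. Littlewood, G. Pólya, *Inequalities*, 2nd ed., §3.18 (Hadamard's theorem).
-/

noncomputable section

open Set MeasureTheory intervalIntegral

namespace Literature.Analysis.Calculus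

/-- **Chord bound**: a convex function lies below its chord: for `x ∈ [a, b]` (`a < b`),
`f x ≤ ((b - x) f a + (x - a) f b)/(b - a)`. [folklore] -/
theorem convexOn_le_chord {s : Set ℝ} {f : ℝ → ℝ} (hf : ConvexOn ℝ s f) {a b x : ℝ}
    (ha : a ∈ s) (hb : b ∈ s) (hab : a < b) (hx : x ∈ Icc a b) :
    f x ≤ ((b - x) * f a + (x - a) * f b) / (b - a) := by
  have hba : 0 < b - a := sub_pos.2 hab
  have hα : 0 ≤ (b - x) / (b - a) := div_nonneg (by linarith [hx.2]) hba.le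
  have hβ : 0 ≤ (x - a) / (b - a) := div_nonneg (by linarith [hx.1]) hba.le
  have hne : b - a ≠ 0 := hba.ne'
  have hαβ : (b - x) / (b - a) + (x - a) / (b - a) = 1 := by
    rw [← add_div, div_eq_one_iff_eq hne]; ring
  have h := hf.2 ha hb hα hβ hαβ
  simp only [smul_eq_mul] at h
  have hx' : (b - x) / (b - a) * a + (x - a) / (b - a) * b = x := by
    field_simp; ring
  rw [hx'] at h
  calc f x ≤ (b - x) / (b - a) * f a + (x - a) / (b - a) * f b := h
    _ = ((b - x) * f a + (x - a) * f b) / (b - a) := by field_simp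

/-- **Trapezoid rule is an upper bound for convex functions**:
`∫_a^b f ≤ (b - a)(f a + f b)/2`. [folklore] -/
theorem convexOn_integral_le_trapezoid {s : Set ℝ} {f : ℝ → ℝ} (hf : ConvexOn ℝ s f) {a b : ℝ}
    (ha : a ∈ s) (hb : b ∈ s) (hab : a < b) (hfi : IntervalIntegrable f volume a b) :
    ∫ x in a..b, f x ≤ (b - a) * (f a + f b) / 2 := by
  have hba : 0 < b - a := sub_pos.2 hab
  have hchord : IntervalIntegrable (fun x ↦ ((b - x) * f a + (x - a) * f b) / (b - a)) volume a b := by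
    apply Continuous.intervalIntegrable; fun_prop
  have hmono := intervalIntegral.integral_mono_on hab.le hfi hchord
    (fun x hx ↦ convexOn_le_chord hf ha hb hab hx)
  refine hmono.trans (le_of_eq ?_)
  have e : (fun x ↦ ((b - x) * f a + (x - a) * f b) / (b - a)) =
      fun x ↦ (b * f a - a * f b) / (b - a) + x * ((f b - f a) / (b - a)) := by
    funext x; field_simp; ring
  have hii : IntervalIntegrable (fun x : ℝ ↦ x * ((f b - f a) / (b - a))) volume a b :=
    (continuous_id.mul continuous_const).intervalIntegrable _ _
  rw [e, intervalIntegral.integral_add (f := fun _ ↦ (b * f a - a * f b) / (b - a))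
      (g := fun x : ℝ ↦ x * ((f b - f a) / (b - a))) intervalIntegrable_const hii,
    intervalIntegral.integral_const, intervalIntegral.integral_mul_const, integral_id, smul_eq_mul]
  have hne : b - a ≠ 0 := hba.ne'
  field_simp
  ring

/-- **Midpoint rule is a lower bound for convex functions**:
`(b - a) f((a+b)/2) ≤ ∫_a^b f` (symmetrise: `2 f(m) ≤ f(a+b−x) + f(x)`). [folklore] -/
theorem convexOn_midpoint_le_integral {s : Set ℝ} {f : ℝ → ℝ} (hf : ConvexOn ℝ s f) {a b : ℝ}
    (hab : a < b) (hsub : Icc a b ⊆ s) (hfi : IntervalIntegrable f volume a b) :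
    (b - a) * f ((a + b) / 2) ≤ ∫ x in a..b, f x := by
  -- the reflected function is integrable with the same integral
  have hrefl_int : IntervalIntegrable (fun x ↦ f (a + b - x)) volume a b := by
    have h := hfi.comp_sub_left (a + b)
    rw [show a + b - a = b by ring, show a + b - b = a by ring] at h
    exact h.symm
  have hrefl : ∫ x in a..b, f (a + b - x) = ∫ x in a..b, f x := by
    rw [intervalIntegral.integral_comp_sub_left (fun x ↦ f x) (a + b),
      show a + b - b = a by ring, show a + b - a = b by ring]
  -- pointwise `2 f(m) ≤ f(a+b-x) + f(x)`
  have hpt : ∀ x ∈ Icc a b, 2 * f ((a + b) / 2) ≤ f (a + b - x) + f x := by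
    intro x hx
    have hx1 : a + b - x ∈ s := hsub ⟨by linarith [hx.2], by linarith [hx.1]⟩
    have hx2 : x ∈ s := hsub hx
    have h := hf.2 hx1 hx2 (show (0 : ℝ) ≤ 1 / 2 by norm_num) (show (0 : ℝ) ≤ 1 / 2 by norm_num)
      (by norm_num)
    simp only [smul_eq_mul] at h
    have : (1 / 2 : ℝ) * (a + b - x) + 1 / 2 * x = (a + b) / 2 := by ring
    rw [this] at h
    linarith
  have hmono := intervalIntegral.integral_mono_on hab.le intervalIntegrable_const (hrefl_int.add hfi) hpt
  rw [intervalIntegral.integral_const, smul_eq_mul, intervalIntegral.integral_add hrefl_int hfi,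
    hrefl] at hmono
  linarith

end Literature.Analysis.Calculus
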